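import Summits.Ventures.Crystal3D.Bulk.GapFaceMeet
import HarnessLib

/-!
# Hexagon packing at the hole and P-L3(h) «r ≤ 2» modulo the hosting map
# (`DESIGN-L12-THEORY.md` §P-L3 (h); ref-2 `REF2-SPRINT.md` S-block), regions-free

HONEST FRAMING. Part of the venture `Summits/Ventures/Crystal3D` (cell `pub-crystal3d`, phase 2;
seat typer-bulk-2). Kernel theorems about every configuration satisfying `CensusRows c`; nothing is
claimed about GAP(1.26). The census enumerates the strata `r ∈ {0, 1, 2}` of rattler counts
(`TARGET-GAP.md` §4.4); the cut `r ≤ 2` is row P-L3(h): «each rattler lies in a `p`-hexagon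
((d1)(d2), T2 §14), at most one per hexagon ((d3), HEX-PERIMETER), and `h` hexagons at the hole
need `≥ 4h` further vertices». This file proves the COUNTING half from the kernel's face
structure (`Bulk/GapVertexSectors`, `Bulk/GapFaceMeet`), with no point-set notion of a face:

* **`CensusRows.hexagon_packing`**: with `H = {a ∈ tightNbrs c 13 | ofaceLen c (a, 13) = 6}`
  (the `p`-hexagons, one per dart into the hole) and `R` the rattlers (shell balls with no tight
  partner), `4 · #H + #R ≤ 12` — the walk vertices at indices `3, 4, 5` of the hexagon of
  `(a, 13)` are three distinct active shell balls, on no other face through the hole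
  (`oface_vertex_ne_of_ne`) and not partners of the hole (`not_mem_tightNbrs_of_oface`);
* **`CensusRows.card_rattlers_le_two_of_hosting`**: if some map sends every rattler to a
  `p`-hexagon `a ∈ H` injectively — the content of (d2) «every rattler is hosted by a
  `p`-hexagon» (p3, `Bulk/GapRattlerHexagon`) and (d3) «at most one rattler per hexagon» (the
  numeric HEX-PERIMETER premise, NOT proved here) — then `#R ≤ 2`;
* `CensusRows.exists_mem_hexagons_of_face`: a face of length `6` through the hole is the hexagon
  of its dart into the hole (the adapter from a hosting face to `H`);
* `CensusRows.card_activeVertices_add_card_rattlers`: `#(activeVertices c ∖ {13}) + #R = 12`.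
-/

noncomputable section

namespace Summit.Ventures.Crystal3D

open Literature.Geometry.DiscreteGeometry Finset Function

variable {c : Fin 14 → EuclideanSpace ℝ (Fin 3)}

/-! ## Active shell balls and rattlers partition the twelve shell balls -/

/-- **`#(activeVertices c ∖ {13}) + #rattlers = 12`**: a shell ball is either active (has a tight
partner) or a rattler. -/
theorem CensusRows.card_activeVertices_add_card_rattlers (h : CensusRows c) :
    ((activeVertices c).erase 13).card +
      (univ.filter fun j : Fin 14 => j ≠ 0 ∧ j ≠ 13 ∧ j ∉ activeVertices c).card = 12 := by
  classical
  set S := (univ.filter fun j : Fin 14 => j ≠ 0 ∧ j ≠ 13) with hS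
  have hScard : S.card = 12 := by rw [hS]; decide
  have hdisj : Disjoint ((activeVertices c).erase 13)
      (univ.filter fun j : Fin 14 => j ≠ 0 ∧ j ≠ 13 ∧ j ∉ activeVertices c) := by
    rw [Finset.disjoint_left]
    intro j hj hj'
    exact (mem_filter.1 hj').2.2.2 (mem_erase.1 hj).2
  have hunion : (activeVertices c).erase 13 ∪
      (univ.filter fun j : Fin 14 => j ≠ 0 ∧ j ≠ 13 ∧ j ∉ activeVertices c) = S := by
    ext j
    rw [mem_union, mem_erase, mem_filter, hS, mem_filter]
    constructor
    · rintro (⟨hj13, hj⟩ | ⟨-, hj0, hj13, -⟩)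
      · exact ⟨mem_univ _, (mem_activeVertices.1 hj).1, hj13⟩
      · exact ⟨mem_univ _, hj0, hj13⟩
    · rintro ⟨-, hj0, hj13⟩
      by_cases hj : j ∈ activeVertices c
      · exact Or.inl ⟨hj13, hj⟩
      · exact Or.inr ⟨mem_univ _, hj0, hj13, hj⟩
  have _ := h.thirteen_mem_activeVertices
  rw [← card_union_of_disjoint hdisj, hunion, hScard]

/-! ## Hexagon packing at the hole -/

/-- The far vertices (walk indices `3, 4, 5`) of the hexagon of the dart `(a, 13)`. -/
theorem CensusRows.card_far_vertices (h : CensusRows c) {a : Fin 14} (ha : a ∈ tightNbrs c 13)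
    (h6 : ofaceLen c (a, 13) = 6) :
    ((Finset.Ico 3 6).image fun n => ((ofaceSucc c)^[n] (a, 13)).1).card = 3 := by
  have hq : (a, (13 : Fin 14)) ∈ darts c := swap_mem_darts (mk_mem_darts (by decide) ha)
  rw [card_image_of_injOn, Nat.card_Ico]
  intro m hm n hn hmn
  rw [coe_Ico, Set.mem_Ico] at hm hn
  by_contra hne
  rcases lt_or_gt_of_ne hne with hlt | hlt
  · exact h.fst_iterate_ofaceSucc_injOn hq hlt (by omega) hmn
  · exact h.fst_iterate_ofaceSucc_injOn hq hlt (by omega) hmn.symm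

/-- The far vertices of a hexagon at the hole are active, `≠ 13`, and not partners of the hole. -/
theorem CensusRows.far_vertices_subset (h : CensusRows c) {a : Fin 14} (ha : a ∈ tightNbrs c 13)
    (h6 : ofaceLen c (a, 13) = 6) :
    ((Finset.Ico 3 6).image fun n => ((ofaceSucc c)^[n] (a, 13)).1) ⊆
      ((activeVertices c).erase 13) \ tightNbrs c 13 := by
  obtain ⟨hD3, -, -⟩ := h.intruderDist_bounds
  have hq : (a, (13 : Fin 14)) ∈ darts c := swap_mem_darts (mk_mem_darts (by decide) ha)
  intro x hx
  obtain ⟨n, hn, rfl⟩ := mem_image.1 hx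
  rw [mem_Ico] at hn
  have hn6 : n < ofaceLen c (a, 13) := by omega
  refine mem_sdiff.2 ⟨mem_erase.2 ⟨?_, ?_⟩, h.not_mem_tightNbrs_of_oface hq (by omega) hn6⟩
  · -- `≠ 13`: index `1` is the hole, vertices are distinct
    have := h.fst_iterate_ofaceSucc_injOn hq (i := 1) (j := n) (by omega) hn6
    intro he
    apply this
    rw [he]
    rfl
  · rw [← image_fst_darts]
    exact mem_image_of_mem _ (h.isGapConfig.iterate_ofaceSucc_mem_darts hD3 hq n)

/-- Far vertices of two different hexagons at the hole are different balls. -/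
theorem CensusRows.far_vertices_disjoint (h : CensusRows c) {a a' : Fin 14}
    (ha : a ∈ tightNbrs c 13) (ha' : a' ∈ tightNbrs c 13) (hne : a ≠ a')
    (h6 : ofaceLen c (a, 13) = 6) (h6' : ofaceLen c (a', 13) = 6) :
    Disjoint ((Finset.Ico 3 6).image fun n => ((ofaceSucc c)^[n] (a, 13)).1)
      ((Finset.Ico 3 6).image fun n => ((ofaceSucc c)^[n] (a', 13)).1) := by
  have hq : (a, (13 : Fin 14)) ∈ darts c := swap_mem_darts (mk_mem_darts (by decide) ha)
  have hq' : (a', (13 : Fin 14)) ∈ darts c := swap_mem_darts (mk_mem_darts (by decide) ha')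
  rw [Finset.disjoint_left]
  intro x hx hx'
  obtain ⟨n, hn, rfl⟩ := mem_image.1 hx
  obtain ⟨n', hn', he⟩ := mem_image.1 hx'
  rw [mem_Ico] at hn hn'
  exact h.oface_vertex_ne_of_ne hq hq' rfl hne (by omega) (by omega) (by omega) (by omega) he.symm

/-- **Hexagon packing at the hole.** With `H` the set of tight partners `a` of the hole whose
face `(a, 13)` is a hexagon (one per `p`-hexagon) and `R` the rattlers:
`4 · #H + #R ≤ 12`. -/
theorem CensusRows.hexagon_packing (h : CensusRows c) :
    4 * ((tightNbrs c 13).filter fun a => ofaceLen c (a, 13) = 6).card +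
      (univ.filter fun j : Fin 14 => j ≠ 0 ∧ j ≠ 13 ∧ j ∉ activeVertices c).card ≤ 12 := by
  classical
  set H := (tightNbrs c 13).filter fun a => ofaceLen c (a, 13) = 6 with hH
  set far : Fin 14 → Finset (Fin 14) :=
    fun a => (Finset.Ico 3 6).image fun n => ((ofaceSucc c)^[n] (a, 13)).1 with hfar
  have hmemH : ∀ {a}, a ∈ H → a ∈ tightNbrs c 13 ∧ ofaceLen c (a, 13) = 6 :=
    fun ha => mem_filter.1 ha
  -- the union of the far vertices has `3 · #H` elements
  set U := H.biUnion far with hU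
  have hUcard : U.card = 3 * H.card := by
    rw [hU, card_biUnion]
    · rw [Finset.sum_const_nat (m := 3) fun a ha => ?_]
      · ring
      · exact h.card_far_vertices (hmemH ha).1 (hmemH ha).2
    · intro a ha a' ha' hne
      exact h.far_vertices_disjoint (hmemH ha).1 (hmemH ha').1 hne (hmemH ha).2 (hmemH ha').2
  -- it misses the partners of the hole, and both lie among the active shell balls
  have hUsub : U ⊆ ((activeVertices c).erase 13) \ tightNbrs c 13 := by
    intro x hx
    obtain ⟨a, ha, hxa⟩ := mem_biUnion.1 hx
    exact h.far_vertices_subset (hmemH ha).1 (hmemH ha).2 hxa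
  have hNsub : tightNbrs c 13 ⊆ (activeVertices c).erase 13 := by
    intro a ha
    exact mem_erase.2 ⟨(mem_tightNbrs.1 ha).2.1, mem_activeVertices_of_mem_tightNbrs (by decide) ha⟩
  have hdisj : Disjoint U (tightNbrs c 13) := by
    rw [Finset.disjoint_left]
    intro x hx hxN
    exact (mem_sdiff.1 (hUsub hx)).2 hxN
  have hle : U.card + (tightNbrs c 13).card ≤ ((activeVertices c).erase 13).card := by
    rw [← card_union_of_disjoint hdisj]
    exact card_le_card (union_subset (fun x hx => (mem_sdiff.1 (hUsub hx)).1) hNsub)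
  have hHle : H.card ≤ (tightNbrs c 13).card := card_le_card (filter_subset _ _)
  have htot := h.card_activeVertices_add_card_rattlers
  omega

/-! ## P-L3(h) «r ≤ 2» modulo the hosting map -/

/-- **P-L3(h) modulo hosting: at most two rattlers.** If every rattler `j` is assigned a tight
partner `f j` of the hole whose face `(f j, 13)` is a hexagon («`j` is hosted by that
`p`-hexagon», (d1)(d2)) and no hexagon hosts two rattlers (`f` injective on the rattlers, (d3)),
then there are at most `2` rattlers: `5 · #R ≤ 4 · #H + #R ≤ 12`. -/
theorem CensusRows.card_rattlers_le_two_of_hosting (h : CensusRows c) (f : Fin 14 → Fin 14)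
    (hf : ∀ j ∈ (univ.filter fun j : Fin 14 => j ≠ 0 ∧ j ≠ 13 ∧ j ∉ activeVertices c),
      f j ∈ (tightNbrs c 13).filter fun a => ofaceLen c (a, 13) = 6)
    (hinj : Set.InjOn f ↑(univ.filter fun j : Fin 14 => j ≠ 0 ∧ j ≠ 13 ∧ j ∉ activeVertices c)) :
    (univ.filter fun j : Fin 14 => j ≠ 0 ∧ j ≠ 13 ∧ j ∉ activeVertices c).card ≤ 2 := by
  classical
  have hpack := h.hexagon_packing
  have hRH : (univ.filter fun j : Fin 14 => j ≠ 0 ∧ j ≠ 13 ∧ j ∉ activeVertices c).card ≤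
      ((tightNbrs c 13).filter fun a => ofaceLen c (a, 13) = 6).card :=
    card_le_card_of_injOn f hf hinj
  omega

/-- **From a hosting face to `H`.** A face of length `6` passing through the hole is the face of
a dart `(a, 13)` into the hole with `a ∈ H` — the adapter that turns «rattler `j` lies in a
hexagonal face through the hole» (p3's `CensusRows.exists_hexagon_of_rattler`) into the hosting
map of `CensusRows.card_rattlers_le_two_of_hosting`. -/
theorem CensusRows.exists_mem_hexagons_of_face (h : CensusRows c) {q : Fin 14 × Fin 14}
    (hq : q ∈ darts c) (h6 : ofaceLen c q = 6)
    (hhole : ∃ t, t < ofaceLen c q ∧ ((ofaceSucc c)^[t] q).1 = 13) :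
    ∃ a ∈ (tightNbrs c 13).filter (fun a => ofaceLen c (a, 13) = 6),
      ofaceOf c (a, 13) = ofaceOf c q := by
  obtain ⟨hD3, -, -⟩ := h.intruderDist_bounds
  have hper := h.isGapConfig.mem_periodicPts_ofaceSucc hD3 hq
  have hF : ofaceOf c q ∈ ofaces c := ofaceOf_mem_ofaces hq
  obtain ⟨t, -, ht⟩ := hhole
  have h13 : (13 : Fin 14) ∈ (ofaceOf c q).image Prod.fst :=
    mem_image.2 ⟨(ofaceSucc c)^[t] q, iterate_mem_ofaceOf hper t, ht⟩
  obtain ⟨a, ha⟩ := h.exists_dart_into hF h13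
  have hqa : (a, (13 : Fin 14)) ∈ darts c := h.isGapConfig.ofaceOf_subset_darts hD3 hq ha
  have haN : a ∈ tightNbrs c 13 := by
    have := snd_mem_tightNbrs_of_mem_darts (swap_mem_darts hqa)
    simpa only [Prod.fst_swap, Prod.snd_swap] using this
  have hface : ofaceOf c (a, 13) = ofaceOf c q := ofaceOf_eq_of_mem hper ha
  refine ⟨a, mem_filter.2 ⟨haN, ?_⟩, hface⟩
  rw [ofaceLen_eq_of_mem hper ha, h6]

end Summit.Ventures.Crystal3D
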